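import Literature.Geometry.Riemannian.LinearHeatWeakExistence
import Literature.Geometry.Riemannian.LinearHeatUniqueness
import HarnessLib

/-!
# Smooth solutions of the forced linear heat equation with forcing supported in `s ≥ 0`

Fourth step of the solvability of the linear heat-type Cauchy problem
`∂ₛw = Δ_{h(s)}w − Qw` on a closed manifold (hypothesis `hLP` of
`perelman_noLocalCollapsing_of_linearHeat`, `hLPs` of
`carrilloNi_muEntropy_eq_log_shrinkerDensity_of_staticLinearHeat`): for a family of Riemannian
metrics `h(s)` and a potential `Q`, both `C^∞` on `M × ℝ`, satisfying the coercivity condition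
`ρ + ½∂ₛρ ≤ ρQ` on `M × [−1, b]` (`ρ = dV_{h(s)}/dV_{g₀}`), and a forcing `G`, `C^∞` on `M × ℝ`
and vanishing for `s ≤ 0`, the equation `∂ₛv = Δ_{h(s)}v − Qv + G` has a solution `v` which is
`C^∞` on the open half space-time `M × (−∞, b)`, vanishes identically for `s ≤ 0`, and solves
the equation classically at every point of `M × (−∞, b)` — in particular up to and across
`s = 0` (`exists_smooth_linearHeat_forcing`). This is Trèves' treatment of the mixed problem
(Trèves 1975, §41, proof of Thm. 40.1, (41.19)–(41.21)) on a closed manifold, assembled from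
the tree:

* Lions' projection lemma gives a very weak `L²` solution `u` on the strip `M × (−1, b)` with
  zero data at `s = −1`, extended by zero (`exists_veryWeak_linearHeat`); since `G = 0` for
  `s ≤ 0`, `u` is a very weak solution on the whole open set `M × (−∞, b)`;
* Hörmander's hypoellipticity of the heat operator (`exists_contMDiffOn_ae_eq_of_linearHeat_veryWeak`)
  replaces `u` by a `C^∞` representative `v` on `M × (−∞, b)`, which solves the equation
  classically (`linearHeat_eq_of_smooth_veryWeak`);
* `v = u = 0` on the open set `M × (−∞, −1)` (continuity, `Measure.eqOn_open_of_ae_eq`), hence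
  `v(−2) = 0`, and the uniqueness theorem for smooth solutions of the homogeneous equation
  (`linearHeat_unique`, Topping 2006, Thm. 3.1.1) on `M × [−2, 0]` gives `v = 0` for `s ≤ 0`.

Also: `hasDerivAt_slice_of_contMDiffOn` (time slices of functions smooth on `M × O`, `O` open),
`laplaceBeltrami_fun_zero`.

Everything is proved; no definitions, no named facts.

## References

* F. Trèves, *Basic Linear Partial Differential Equations*, Academic Press 1975, §41,
  Thm. 40.1, Lemma 41.2, (41.19)–(41.21). [Treves1975]
* L. Hörmander, Acta Math. 119 (1967), Thm 1.1. [Hormander1967]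
* P. Topping, *Lectures on the Ricci flow* (2006), Thm. 3.1.1, Rem. 8.2.5. [Topping2006]
-/

noncomputable section

open Bundle Set Function Filter Manifold MeasureTheory Measure TopologicalSpace
open scoped Manifold ContDiff Topology ENNReal

namespace Literature.Geometry.Riemannian

open Lorentzian Lorentzian.PseudoRiemannianMetric

variable {m : ℕ} {H : Type*} [TopologicalSpace H]
  {I : ModelWithCorners ℝ (EuclideanSpace ℝ (Fin m)) H} [I.Boundaryless]
  {M : Type*} [TopologicalSpace M] [ChartedSpace H M] [IsManifold I ∞ M]
  [T2Space M] [CompactSpace M] [SecondCountableTopology M] [MeasurableSpace M] [BorelSpace M]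
  {h : ℝ → PseudoRiemannianMetric I ∞ (EuclideanSpace ℝ (Fin m)) (TangentSpace I : M → Type _)}
  {g₀ : PseudoRiemannianMetric I ∞ (EuclideanSpace ℝ (Fin m)) (TangentSpace I : M → Type _)}

/-! ### Slices of functions smooth on `M × O`, `O ⊆ ℝ` open -/

section Slices

omit [I.Boundaryless] [IsManifold I ∞ M] [T2Space M] [CompactSpace M] [SecondCountableTopology M]
  [MeasurableSpace M] [BorelSpace M] in
/-- A function `C^∞` on `M × O`, `O` open, has differentiable time slices at the points of `O`,
with the two-sided derivative `deriv`. [folklore] -/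
theorem hasDerivAt_slice_of_contMDiffOn {O : Set ℝ} (hO : IsOpen O) {v : M × ℝ → ℝ}
    (hv : ContMDiffOn (I.prod 𝓘(ℝ, ℝ)) 𝓘(ℝ, ℝ) ∞ v (univ ×ˢ O)) (x : M) {s : ℝ} (hs : s ∈ O) :
    HasDerivAt (fun r ↦ v (x, r)) (deriv (fun r ↦ v (x, r)) s) s := by
  have h1 := hasDerivWithinAt_time_of_contMDiffOn (I := I) (k := ∞) (by simp)
    (u := fun r y ↦ v (y, r)) (S := O) hv x hs
  have h2 : HasDerivAt (fun r ↦ v (x, r)) (derivWithin (fun r ↦ v (x, r)) O s) s :=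
    h1.hasDerivAt (hO.mem_nhds hs)
  rwa [derivWithin_of_isOpen hO hs] at h2

omit [I.Boundaryless] [T2Space M] [CompactSpace M] [SecondCountableTopology M]
  [MeasurableSpace M] [BorelSpace M] in
/-- `Δ_g 0 = 0`. [folklore] -/
theorem laplaceBeltrami_fun_zero
    (g : PseudoRiemannianMetric I ∞ (EuclideanSpace ℝ (Fin m)) (TangentSpace I : M → Type _))
    (x : M) : g.laplaceBeltrami (fun _ : M ↦ (0 : ℝ)) x = 0 := by
  haveI := g.hasLeviCivita
  rw [laplaceBeltrami_eq_dalembertian]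
  exact g.dalembertian_eq_zero_of_eventuallyEq_zero (Eventually.of_forall fun _ ↦ rfl)

end Slices

/-! ### The forced problem -/

section Forced

variable (hh : IsContMDiffFamilyOn ∞ h univ) (hR : ∀ s, (h s).IsRiemannian)
  (hR₀ : g₀.IsRiemannian) {Q G : ℝ → M → ℝ}
  (hQ : ContMDiff (I.prod 𝓘(ℝ, ℝ)) 𝓘(ℝ, ℝ) ∞ fun p : M × ℝ ↦ Q p.2 p.1)
  (hG : ContMDiff (I.prod 𝓘(ℝ, ℝ)) 𝓘(ℝ, ℝ) ∞ fun p : M × ℝ ↦ G p.2 p.1)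

include hh hR hR₀ hQ hG in
/-- **Smooth solutions of the forced linear heat equation with forcing supported in `s ≥ 0`**
(Trèves 1975, §41, Thm. 40.1, on a closed manifold). Let `h(s)` be a family of Riemannian
metrics and `Q` a potential, `C^∞` on `M × ℝ`, `g₀` a Riemannian reference metric with
`ρ = dV_{h(s)}/dV_{g₀}`, `0 < b`, and assume the coercivity condition `ρ + ½∂ₛρ ≤ ρQ` on
`M × [−1, b]`. For every forcing `G`, `C^∞` on `M × ℝ` with `G(s) = 0` for `s ≤ 0`, there is
`v : M × ℝ → ℝ`, `C^∞` on `M × (−∞, b)`, with `v(x, s) = 0` for `s ≤ 0` and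
`∂ₛv = Δ_{h(s)}v − Qv + G` at every point of `M × (−∞, b)`. Proof: Lions' very weak solution on
`M × (−1, b)` extended by zero (`exists_veryWeak_linearHeat`) is very weak on `M × (−∞, b)`;
it is a.e. a `C^∞` function there (Hörmander, `exists_contMDiffOn_ae_eq_of_linearHeat_veryWeak`)
solving the equation classically (`linearHeat_eq_of_smooth_veryWeak`), vanishing on
`M × (−∞, −1)` by continuity and on `M × [−2, 0]` by uniqueness (`linearHeat_unique`).
[cite: Treves1975, §41, Thm. 40.1 and (41.19)–(41.21)] -/
theorem exists_smooth_linearHeat_forcing (hG0 : ∀ s ≤ (0 : ℝ), ∀ x, G s x = 0) {b : ℝ}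
    (hb : 0 < b)
    (hcoer : ∀ (x : M), ∀ s ∈ Icc (-1 : ℝ) b, (h s).densityRatio g₀ x +
      deriv (fun s ↦ (h s).densityRatio g₀ x) s / 2 ≤ (h s).densityRatio g₀ x * Q s x) :
    ∃ v : M × ℝ → ℝ, ContMDiffOn (I.prod 𝓘(ℝ, ℝ)) 𝓘(ℝ, ℝ) ∞ v (univ ×ˢ Iio b) ∧
      (∀ x, ∀ s ≤ (0 : ℝ), v (x, s) = 0) ∧
      ∀ x, ∀ s < b, deriv (fun r ↦ v (x, r)) s =
        (h s).laplaceBeltrami (fun y ↦ v (y, s)) x - Q s x * v (x, s) + G s x := by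
  classical
  set μ₀ : Measure M := g₀.riemVolume with hμ₀
  haveI : IsFiniteMeasure μ₀ := by
    rw [hμ₀, riemVolume_eq hR₀]; exact isFiniteMeasure_riemannianMeasure _
  haveI : μ₀.IsOpenPosMeasure := by
    rw [hμ₀, riemVolume_eq hR₀]; exact isOpenPosMeasure_riemannianMeasure _
  haveI : (μ₀.prod (volume : Measure ℝ)).IsOpenPosMeasure := prod.instIsOpenPosMeasure
  have hab : (-1 : ℝ) < b := by linarith
  -- Lions' very weak solution on `M × (-1, b)`, extended by zero
  obtain ⟨u, hum, hu2, hu0, huweak⟩ := exists_veryWeak_linearHeat hh hR hR₀ hQ hG hab hcoer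
  -- it is a very weak solution on `M × (-∞, b)` (the forcing vanishes for `s ≤ 0`)
  have huweak' : ∀ ζ : M × ℝ → ℝ, ContMDiff (I.prod 𝓘(ℝ, ℝ)) 𝓘(ℝ, ℝ) ∞ ζ → HasCompactSupport ζ →
      tsupport ζ ⊆ univ ×ˢ Iio b →
      ∫ p, u p * (-(deriv (fun s ↦ (h s).densityRatio g₀ p.1 * ζ (p.1, s)) p.2) -
          (h p.2).densityRatio g₀ p.1 * (h p.2).laplaceBeltrami (fun x ↦ ζ (x, p.2)) p.1 +
          (h p.2).densityRatio g₀ p.1 * Q p.2 p.1 * ζ p) ∂μ₀.prod (volume : Measure ℝ) =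
        ∫ p, (h p.2).densityRatio g₀ p.1 * G p.2 p.1 * ζ p ∂μ₀.prod (volume : Measure ℝ) := by
    intro ζ hζ hζc hζb
    rw [huweak ζ hζ hζc hζb]
    refine setIntegral_eq_integral_of_forall_compl_eq_zero fun p hp ↦ ?_
    by_cases hpb : p.2 < b
    · have hpa : p.2 ≤ -1 := by
        by_contra h'
        exact hp ⟨mem_univ _, not_le.1 h', hpb⟩
      rw [hG0 p.2 (by linarith) p.1, mul_zero, zero_mul]
    · have hp' : p ∉ tsupport ζ := fun h' ↦ hpb (hζb h').2
      rw [image_eq_zero_of_notMem_tsupport hp', mul_zero]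
  -- interior regularity on the open time set `(-∞, b)`
  have hS : (μ₀.prod (volume : Measure ℝ)) (univ ×ˢ Ioo (-1 : ℝ) b) ≠ ⊤ := by
    rw [Measure.prod_prod]
    exact (ENNReal.mul_lt_top (measure_lt_top _ _) measure_Ioo_lt_top).ne
  have hu1 : Integrable u (μ₀.prod (volume : Measure ℝ)) :=
    memLp_one_iff_integrable.1 (hu2.mono_exponent_of_measure_support_ne_top
      (s := univ ×ˢ Ioo (-1 : ℝ) b) (fun p hp ↦ hu0 p fun h' ↦ hp ⟨mem_univ _, h'⟩) hS
      (by norm_num))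
  obtain ⟨v, hv, hae⟩ := exists_contMDiffOn_ae_eq_of_linearHeat_veryWeak hh hR hR₀ hQ hG
    isOpen_Iio hum (hu1.locallyIntegrable.locallyIntegrableOn _) huweak'
  -- the weak identity for the smooth representative
  have hvweak : ∀ ζ : M × ℝ → ℝ, ContMDiff (I.prod 𝓘(ℝ, ℝ)) 𝓘(ℝ, ℝ) ∞ ζ → HasCompactSupport ζ →
      tsupport ζ ⊆ univ ×ˢ Iio b →
      ∫ p, v p * (-(deriv (fun s ↦ (h s).densityRatio g₀ p.1 * ζ (p.1, s)) p.2) -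
          (h p.2).densityRatio g₀ p.1 * (h p.2).laplaceBeltrami (fun x ↦ ζ (x, p.2)) p.1 +
          (h p.2).densityRatio g₀ p.1 * Q p.2 p.1 * ζ p) ∂μ₀.prod (volume : Measure ℝ) =
        ∫ p, (h p.2).densityRatio g₀ p.1 * G p.2 p.1 * ζ p ∂μ₀.prod (volume : Measure ℝ) := by
    intro ζ hζ hζc hζb
    rw [← huweak' ζ hζ hζc hζb]
    refine integral_congr_ae ?_
    filter_upwards [hae] with p hp
    by_cases hpz : p ∈ tsupport ζ
    · rw [hp (hζb hpz)]
    · simp only [heatAdjoint_eq_zero_of_notMem_tsupport hpz, mul_zero]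
  -- the classical equation on `M × (-∞, b)`
  have hclass : ∀ x, ∀ s < b, deriv (fun r ↦ v (x, r)) s =
      (h s).laplaceBeltrami (fun y ↦ v (y, s)) x - Q s x * v (x, s) + G s x := by
    intro x s hs
    have hsub : univ ×ˢ Ioo (s - 1) b ⊆ (univ : Set M) ×ˢ Iio b :=
      prod_mono le_rfl Ioo_subset_Iio_self
    have hs' : ((x, s) : M × ℝ).2 ∈ Ioo (s - 1) b := ⟨by simp only; linarith, hs⟩
    exact linearHeat_eq_of_smooth_veryWeak hh hR hR₀ hQ hG (hv.mono hsub)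
      (fun ζ hζ hζc hζs ↦ hvweak ζ hζ hζc (hζs.trans hsub)) hs'
  -- `v = 0` on `M × (-∞, -1)`, where `u = 0`
  have hv0 : ∀ x, ∀ s < (-1 : ℝ), v (x, s) = 0 := by
    have hO : IsOpen ((univ : Set M) ×ˢ Iio (-1 : ℝ)) := isOpen_univ.prod isOpen_Iio
    have hsub : (univ : Set M) ×ˢ Iio (-1 : ℝ) ⊆ univ ×ˢ Iio b :=
      prod_mono le_rfl (Iio_subset_Iio hab.le)
    have heq : EqOn v 0 ((univ : Set M) ×ˢ Iio (-1 : ℝ)) := by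
      refine Measure.eqOn_open_of_ae_eq (μ := μ₀.prod (volume : Measure ℝ)) ?_ hO
        (hv.mono hsub).continuousOn continuousOn_const
      rw [Filter.EventuallyEq, ae_restrict_iff' hO.measurableSet]
      filter_upwards [hae] with p hp hpO
      rw [← hp (hsub hpO), Pi.zero_apply]
      exact hu0 p fun h' ↦ lt_irrefl _ (h'.1.trans hpO.2)
    intro x s hs
    exact heq ⟨mem_univ _, hs⟩
  -- `v = 0` on `M × [-2, 0]` by uniqueness for the homogeneous equation (time shift `r = s + 2`)
  have hv00 : ∀ x, ∀ s ∈ Icc (-2 : ℝ) 0, v (x, s) = 0 := by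
    have h2 : (0 : ℝ) < 2 := two_pos
    have hshift : ContMDiff (I.prod 𝓘(ℝ, ℝ)) (I.prod 𝓘(ℝ, ℝ)) ∞
        (fun p : M × ℝ ↦ ((p.1, p.2 - 2) : M × ℝ)) :=
      contMDiff_fst.prodMk (contMDiff_snd.sub contMDiff_const)
    have hmaps : MapsTo (fun p : M × ℝ ↦ ((p.1, p.2 - 2) : M × ℝ)) (univ ×ˢ Icc (0 : ℝ) 2)
        (univ ×ˢ Iio b) :=
      fun p hp ↦ ⟨mem_univ _, by simp only [mem_Iio]; linarith [hp.2.2]⟩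
    have hw₁ : ContMDiffOn (I.prod 𝓘(ℝ, ℝ)) 𝓘(ℝ, ℝ) ∞
        (fun p : M × ℝ ↦ (fun r y ↦ v (y, r - 2)) p.2 p.1) (univ ×ˢ Icc (0 : ℝ) 2) :=
      hv.comp hshift.contMDiffOn hmaps
    have hw₁eq : ∀ r ∈ Icc (0 : ℝ) 2, ∀ x : M,
        HasDerivWithinAt (fun r' ↦ (fun r y ↦ v (y, r - 2)) r' x)
          ((h (r - 2)).laplaceBeltrami ((fun r y ↦ v (y, r - 2)) r) x -
            Q (r - 2) x * (fun r y ↦ v (y, r - 2)) r x) (Icc (0 : ℝ) 2) r := by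
      intro r hr x
      have hrb : r - 2 < b := by linarith [hr.2]
      have hd := hasDerivAt_slice_of_contMDiffOn isOpen_Iio hv x hrb
      rw [hclass x (r - 2) hrb, hG0 (r - 2) (by linarith [hr.2]) x, add_zero] at hd
      have hc : HasDerivAt (fun r' : ℝ ↦ r' - 2) 1 r := (hasDerivAt_id r).sub_const 2
      have h3 : HasDerivAt (fun r' ↦ v (x, r' - 2))
          ((h (r - 2)).laplaceBeltrami (fun y ↦ v (y, r - 2)) x - Q (r - 2) x * v (x, r - 2))
          r := by
        have := hd.comp r hc
        simpa only [Function.comp_def, mul_one] using this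
      exact h3.hasDerivWithinAt
    have hw₂ : ContMDiffOn (I.prod 𝓘(ℝ, ℝ)) 𝓘(ℝ, ℝ) ∞
        (fun p : M × ℝ ↦ (fun (_ : ℝ) (_ : M) ↦ (0 : ℝ)) p.2 p.1) (univ ×ˢ Icc (0 : ℝ) 2) :=
      contMDiffOn_const
    have hw₂eq : ∀ r ∈ Icc (0 : ℝ) 2, ∀ x : M,
        HasDerivWithinAt (fun r' ↦ (fun (_ : ℝ) (_ : M) ↦ (0 : ℝ)) r' x)
          ((h (r - 2)).laplaceBeltrami ((fun (_ : ℝ) (_ : M) ↦ (0 : ℝ)) r) x -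
            Q (r - 2) x * (fun (_ : ℝ) (_ : M) ↦ (0 : ℝ)) r x) (Icc (0 : ℝ) 2) r := by
      intro r _ x
      have h0 : (h (r - 2)).laplaceBeltrami (fun _ : M ↦ (0 : ℝ)) x = 0 :=
        laplaceBeltrami_fun_zero _ _
      simp only [h0, mul_zero, sub_zero]
      exact hasDerivWithinAt_const _ _ _
    have hQc : ContinuousOn (fun p : M × ℝ ↦ (fun r y ↦ Q (r - 2) y) p.2 p.1)
        (univ ×ˢ Icc (0 : ℝ) 2) :=
      (hQ.continuous.comp hshift.continuous).continuousOn
    have h0 : (fun r y ↦ v (y, r - 2)) 0 = (fun (_ : ℝ) (_ : M) ↦ (0 : ℝ)) 0 := by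
      funext y
      exact hv0 y (0 - 2) (by norm_num)
    intro x s hs
    have key := linearHeat_unique (I := I) (M := M) (g := fun r ↦ h (r - 2))
      (Q := fun r y ↦ Q (r - 2) y) (T := 2) h2 (fun r _ ↦ hR (r - 2)) hQc hw₁ hw₁eq hw₂ hw₂eq
      h0 (s := s + 2) ⟨by linarith [hs.1], by linarith [hs.2]⟩ x
    simpa only [add_sub_cancel_right] using key
  refine ⟨v, hv, fun x s hs ↦ ?_, hclass⟩
  rcases lt_or_ge s (-1) with hs' | hs'
  · exact hv0 x s hs'
  · exact hv00 x s ⟨by linarith, hs⟩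

end Forced

end Literature.Geometry.Riemannian
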